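import Summits.BirchSwinnertonDyer.Rank1Residual.O5.CongruentCompanionTorsion
import Literature.NumberTheory.EllipticCurves.ModPIrreducibleCongruenceTransferProofs
import HarnessLib

/-!
# O5 — a mod-3 congruent companion of a curve with irreducible `W[3]` has irreducible `G[3]`:
# the docstrings' "so `ρ̄_G ≅ ρ̄_W` by Brauer–Nesbitt–Chebotarev" as a tree theorem for
# irreducibility (cell `b2b-bsdres`, lane CLASS-CLOSURE, class O5; harvest seat 2, GEN 52, E108)

HONEST FRAMING (cell `b2b-bsdres`, run/shared/lean/b2b/bsd-rank1-residual/, verbatim in every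
file): the goal of the cell is to DELETE the COMBINATION-SHAPED residual classes of the
Birch–Swinnerton-Dyer formula for ALL analytic-rank `≤ 1` elliptic curves over `ℚ` — "full BSD
formula for every rank `≤ 1` curve in class `C`" assembled STRICTLY from published theorems — so
that the rank-`≤ 1` remainder becomes exactly the CONSTRUCTION-SHAPED classes, which are TYPED
(missing-input `Prop`s), NOT attempted. This is not "finishing BSD". Lane CLASS-CLOSURE: research
routes; no claim beyond the stated classes; nothing is booked here; no mark of `RESIDUAL-MAP.md`
moves; census numbers are EVIDENCE. THEOREMS ONLY (no definition, no named fact, no conjecture node;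
net named-fact debt `0`); no node file is touched.

## What this file does

The O5 vocabulary `IsCongruentModThree W G` (`O5GlobalLine`) / `IsCompanionAtThree W G`
(`O5CompanionTransport`) carries the docstring remark "so `ρ̄_W^{ss} ≅ ρ̄_X^{ss}` by
Brauer–Nesbitt–Chebotarev, and `ρ̄_W ≅ ρ̄_X` when `ρ̄_W` is irreducible".  The IRREDUCIBILITY half of
that remark is now a tree theorem (`Literature/…/ModPIrreducibleCongruenceTransferProofs.lean`,
harvest-2 GEN 52: Chebotarev for `ℚ(W[p], G[p])` via the tree's proved `chebotarevArtinRep_holds`,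
`det`/`tr` of Frobenius on `E[p]`, the eigenvalue of a stable line and the invariant line of the
twisted representation — Darmon–Diamond–Taylor 1995 Prop. 2.6 (b) / 2.8 (a) / 2.11 (a)); this file
spells it in the O5 vocabulary:

* `hasIrreducibleModPGaloisRep_of_isCongruentModThree : W.HasIrreducibleModPGaloisRep 3 →
  IsCongruentModThree W G → G.HasIrreducibleModPGaloisRep 3`, and the `iff` form;
* `hasIrreducibleModPGaloisRep_of_isCompanionAtThree`;
* `natCard_torsionBy_eq_one_left_of_isCongruentModThree` — the torsion statement of
  `CongruentCompanionTorsion` also for `W` from `Irr G 3` (symmetry).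

Consequence for the typer (doc-only): in any O5 / X4 node quantifying over a congruent pair with
`W.HasIrreducibleModPGaloisRep 3`, a second hypothesis `G.HasIrreducibleModPGaloisRep 3` (e.g. E103's
`crudeTransferUpperUnit_of_transfer_of_irr`) is redundant.

References: H. Darmon, F. Diamond, R. Taylor, *Fermat's Last Theorem* (1995) Prop. 2.6 (b), 2.8 (a),
2.11 (a) [DarmonDiamondTaylor1995]; cell: `O5/O5GlobalLine.lean`, `O5/O5CompanionTransport.lean`,
`O5/CongruentCompanionTorsion.lean`, HOME/b2b-bsdres-harvest-2/gen52/E107 (§E108).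
-/

set_option autoImplicit false

noncomputable section

open WeierstrassCurve Literature.NumberTheory.EllipticCurves

namespace Summit.BirchSwinnertonDyer.Rank1Residual.O5

variable (W G : WeierstrassCurve ℚ) [W.IsElliptic] [W.IsGloballyMinimal] [G.IsElliptic]
  [G.IsGloballyMinimal]

/-- **A mod-3 congruent companion of a curve with irreducible `W[3]` has irreducible `G[3]`**
(`IsCongruentModThree W G`: `a_ℓ(W) ≡ a_ℓ(G) (mod 3)` at every prime `ℓ ∤ 3 N_W N_G`; the Literature
theorem `hasIrreducibleModPGaloisRep_of_frobeniusTrace_congr_off_finite` with `S = {ℓ ≤ 3 N_W N_G}`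
and `frobeniusTrace_congr_of_isCongruentModThree`).
[cite: DarmonDiamondTaylor1995, Prop. 2.6 (b), Prop. 2.8 (a), Prop. 2.11 (a) (PDF pp. 53–57)] -/
theorem hasIrreducibleModPGaloisRep_of_isCongruentModThree (hirr : W.HasIrreducibleModPGaloisRep 3)
    (hcong : IsCongruentModThree W G) : G.HasIrreducibleModPGaloisRep 3 :=
  hasIrreducibleModPGaloisRep_of_frobeniusTrace_congr_off_finite W G 3 hirr
    {ℓ | ℓ ≤ 3 * W.conductorNorm ℤ * G.conductorNorm ℤ} (Set.finite_le_nat _)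
    (fun ℓ _ hℓS hgW hgG ↦ by
      have h3 := frobeniusTrace_congr_of_isCongruentModThree W G hcong ℓ hℓS hgW hgG
      rwa [Nat.cast_ofNat])

/-- Along a mod-3 congruence (`IsCongruentModThree W G`), `W[3]` is irreducible iff `G[3]` is.
[cite: DarmonDiamondTaylor1995, Prop. 2.6 (b) (PDF p. 53)] -/
theorem hasIrreducibleModPGaloisRep_iff_of_isCongruentModThree (hcong : IsCongruentModThree W G) :
    W.HasIrreducibleModPGaloisRep 3 ↔ G.HasIrreducibleModPGaloisRep 3 :=
  hasIrreducibleModPGaloisRep_iff_of_frobeniusTrace_congr_off_finite W G 3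
    {ℓ | ℓ ≤ 3 * W.conductorNorm ℤ * G.conductorNorm ℤ} (Set.finite_le_nat _)
    (fun ℓ _ hℓS hgW hgG ↦ by
      have h3 := frobeniusTrace_congr_of_isCongruentModThree W G hcong ℓ hℓS hgW hgG
      rwa [Nat.cast_ofNat])

/-- **A semistable companion at `3` (`IsCompanionAtThree W G`) of a curve with irreducible `W[3]`
has irreducible `G[3]`.** [cite: DarmonDiamondTaylor1995, Prop. 2.6 (b) (PDF p. 53)] -/
theorem hasIrreducibleModPGaloisRep_of_isCompanionAtThree (hirr : W.HasIrreducibleModPGaloisRep 3)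
    (hcomp : IsCompanionAtThree W G) : G.HasIrreducibleModPGaloisRep 3 :=
  hasIrreducibleModPGaloisRep_of_isCongruentModThree W G hirr hcomp.2

/-- Symmetry of the torsion statement of `CongruentCompanionTorsion`: along a mod-3 congruence with
`G[3]` irreducible, also `#W(ℚ)[3] = 1` (irreducibility passes to `W`, then Mazur-free:
`natCard_torsionBy_eq_one_of_hasIrreducibleModPGaloisRep`).
[cite: DarmonDiamondTaylor1995, Prop. 2.6 (b) (PDF p. 53)] -/
theorem natCard_torsionBy_eq_one_left_of_isCongruentModThree
    (hirrG : G.HasIrreducibleModPGaloisRep 3) (hcong : IsCongruentModThree W G) :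
    Nat.card (AddSubgroup.torsionBy W.toAffine.Point 3) = 1 := by
  have hirrW : W.HasIrreducibleModPGaloisRep 3 :=
    (hasIrreducibleModPGaloisRep_iff_of_isCongruentModThree W G hcong).mpr hirrG
  have h := natCard_torsionBy_eq_one_of_hasIrreducibleModPGaloisRep W 3 hirrW
  rwa [Nat.cast_ofNat] at h

end Summit.BirchSwinnertonDyer.Rank1Residual.O5

end
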